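import Literature.Topology.FourManifolds.StraightLineIsotopyExtension
import HarnessLib

/-!
# Isotopy extension for straight-line isotopies: support in a prescribed neighbourhood and
# relative to a set which only stationary tracks visit

Topic `Literature/Topology/FourManifolds` (differential topology in a finite-dimensional real
vector space `E`). Sibling of `StraightLineIsotopyExtension.lean` and
`StraightLineIsotopyExtensionSupport.lean`, which prove the isotopy extension theorem of Hirsch,
*Differential Topology* (1976), Ch. 8 §1, Thms. 1.3–1.4, for the straight-line isotopies
`h_t = id + t (P - id)` near a compact set `Z` on which `P = id`: a diffeomorphism `Φ` of `E`
equal to `P` near `Z`, to the identity off a prescribed open `W' ⊇ Z`, and off a ball. Here one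
more control is added, needed when the prescribed neighbourhood `W'` of `Z` unavoidably contains
points that must not move (uniqueness of tubular neighbourhoods of an ARC relative to its end
points: near the ends the comparison map `P` is already the identity, but the closed set to be
fixed reaches the arc there):

* `Literature.Topology.FourManifolds.exists_diffeomorph_eqOn_nhdsSet_of_straightLine_rel_of_forall`,
  `Literature.Topology.FourManifolds.exists_diffeomorph_eqOn_nhdsSet_of_straightLine_rel` — if
  `C ⊆ E` is any set such that, for `y` near `Z` (resp. for `y ∈ W`) and `t ∈ [-1, 2]`,
  **`h_t(y) ∈ C` forces `P y = y`** (the only straight-line tracks which visit `C` are the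
  stationary ones), then `Φ` may moreover be taken to be **the identity on `C`**.

This is Hirsch's Thm. 1.3/1.4 as printed (*"the diffeotopy generated by `G`"*, Ch. 8 §1, PDF
p. 167) read off the generating field: the field `X(t, y) = ρ(t, y) (P - id)(pr₂ Ĥ⁻¹(t, y))` of
`StraightLineIsotopyExtension.lean` (cut off inside the image `Ω` of the track `Ĥ`) vanishes at
`(t, y)` whenever `y ∈ C`: either `(t, y) ∉ Ω`, where the cut-off vanishes, or `(t, y) = Ĥ(t, y')`
with `h_t(y') = y ∈ C`, whence `P y' = y'` and the field is `ρ · (P y' - y') = 0`; a point at which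
a time-dependent field vanishes at all times is fixed by its flow
(`Literature.Analysis.ODE.tdFlow_eq_self_of_forall_eq_zero`). The same computation with `C = E ∖ W'`
is the support statement of `StraightLineIsotopyExtensionSupport.lean` (Kosinski, *Differential
Manifolds* (1993), II (5.2): *"we can assume that `Y` vanishes outside of some neighborhood `U` of
`B = G(K × [0, 1])`"*), reproved here so that both controls hold for one `Φ`.

The proof below is that of `exists_diffeomorph_eqOn_nhdsSet_of_straightLine_of_subset` verbatim
(track, inverse function theorem, cut-off field, time-one map of the flow), with the time window of
the track kept inside `[-1, 2]` and the vanishing of the field over `C` added at the end.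

## References

* M. W. Hirsch, *Differential Topology*, GTM 33, Springer (1976), Ch. 8 §1, Thms. 1.1–1.4
  (PDF pp. 166–167). [Hirsch1976]
* A. Kosinski, *Differential Manifolds*, Academic Press (1993), Ch. II, Thm. (5.2); Ch. III,
  Thm. (3.5). [Kosinski1993]

## Design notes

* Everything in this file is proved; no definition and no named fact is introduced.
* The time window `[-1, 2]` in the hypothesis on `C` is any fixed neighbourhood of `[0, 1]`; the
  flow is only run near `[0, 1]`.
-/

noncomputable section

open Set Metric Filter Topology Function
open scoped ContDiff NNReal Manifold

namespace Literature.Topology.FourManifolds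

universe u

section Extension

variable {E : Type u} [NormedAddCommGroup E] [NormedSpace ℝ E] [FiniteDimensional ℝ E]

/-- **Isotopy extension for straight-line isotopies near a compact set, with support in a
prescribed neighbourhood and relative to a set visited only by stationary tracks** (Hirsch,
*Differential Topology* (1976), Ch. 8 §1, Thms. 1.3–1.4, for the isotopy `h_t = id + t (P - id)`;
Kosinski (1993), II.(5.2)). Let `Z` be a compact subset of a finite-dimensional real normed space
`E`, `P` a `C^∞` map on an open `W ⊇ Z` with `P z = z` on `Z`, with derivative `D z` at the points
of `Z`, such that `id + t (D z - id)` is injective for all `z ∈ Z`, `t ∈ [0, 1]`; let `W'` be any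
open set containing `Z`, and `C` any set such that `P y = y` whenever `y ∈ W`, `t ∈ [-1, 2]` and
`h_t(y) ∈ C`. Then there is a diffeomorphism `Φ` of `E` with `Φ = P` on a neighbourhood of `Z`,
`Φ = id` off `W'`, `Φ = id` on `C`, and `Φ = id` off a ball. [cite: Hirsch1976, Ch. 8 §1, Thm. 1.3] -/
theorem exists_diffeomorph_eqOn_nhdsSet_of_straightLine_rel_of_forall {Z W : Set E}
    (hZ : IsCompact Z) (hW : IsOpen W) (hZW : Z ⊆ W) {P : E → E} (hP : ContDiffOn ℝ ∞ P W)
    (hPZ : ∀ z ∈ Z, P z = z) {D : E → E →L[ℝ] E} (hD : ∀ z ∈ Z, HasFDerivAt P (D z) z)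
    (hinj : ∀ z ∈ Z, ∀ t ∈ Icc (0 : ℝ) 1, Injective (slDeriv t (D z)))
    {W' : Set E} (hW' : IsOpen W') (hZW' : Z ⊆ W') {C : Set E}
    (hCW : ∀ y ∈ W, ∀ t ∈ Icc (-1 : ℝ) 2, slIsotopy P t y ∈ C → P y = y) :
    ∃ Φ : E ≃ₘ⟮𝓘(ℝ, E), 𝓘(ℝ, E)⟯ E, (∀ᶠ y in 𝓝ˢ Z, Φ y = P y) ∧
      (∀ y, y ∉ W' → Φ y = y) ∧ (∀ y ∈ C, Φ y = y) ∧ ∃ R : ℝ, ∀ y : E, R ≤ ‖y‖ → Φ y = y := by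
  have hPdiff : ∀ y ∈ W, HasFDerivAt P (fderiv ℝ P y) y := fun y hy =>
    ((hP.contDiffAt (hW.mem_nhds hy)).differentiableAt (by simp)).hasFDerivAt
  have hDeq : ∀ z ∈ Z, fderiv ℝ P z = D z := fun z hz => (hD z hz).fderiv
  -- Step 1: the set `S` of `(t, y)`, `y ∈ W`, where `id + t (DP(y) - id)` is invertible is open
  set A : ℝ × E → E →L[ℝ] E := fun q => slDeriv q.1 (fderiv ℝ P q.2) with hA
  have hAcont : ContinuousOn A ((univ : Set ℝ) ×ˢ W) := by
    have hf : ContinuousOn (fun q : ℝ × E => fderiv ℝ P q.2) ((univ : Set ℝ) ×ˢ W) :=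
      (hP.continuousOn_fderiv_of_isOpen hW (by simp)).comp continuousOn_snd fun q hq => hq.2
    simp only [hA, slDeriv]
    exact continuousOn_const.add (continuousOn_fst.smul (hf.sub continuousOn_const))
  set S : Set (ℝ × E) := ((univ : Set ℝ) ×ˢ W) ∩ A ⁻¹' {u | IsUnit u} with hS
  have hSopen : IsOpen S := hAcont.isOpen_inter_preimage (isOpen_univ.prod hW) Units.isOpen
  -- the equivalences `T q` and the derivative of the track on `S`
  have hequiv : ∀ q ∈ S, ∃ T : (ℝ × E) ≃L[ℝ] ℝ × E,
      HasFDerivAt (slTrack P) (T : ℝ × E →L[ℝ] ℝ × E) q := by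
    rintro ⟨t, y⟩ ⟨⟨-, hyW⟩, hunit⟩
    have hunit' : IsUnit (slDeriv t (fderiv ℝ P y)) := hunit
    set L : E ≃L[ℝ] E := ContinuousLinearEquiv.unitsEquiv ℝ E hunit'.unit with hL
    have hLcoe : (L : E →L[ℝ] E) = slDeriv t (fderiv ℝ P y) := by
      rw [hL]; ext η; simp
    refine ⟨slTrackEquiv L (P y - y), ?_⟩
    rw [coe_slTrackEquiv L hLcoe]
    exact hasFDerivAt_slTrack (hPdiff y hyW)
  have hKS : Icc (0 : ℝ) 1 ×ˢ Z ⊆ S := by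
    rintro ⟨t, z⟩ ⟨ht, hz⟩
    refine ⟨⟨mem_univ _, hZW hz⟩, ?_⟩
    show IsUnit (slDeriv t (fderiv ℝ P z))
    rw [hDeq z hz]
    obtain ⟨L, hL⟩ := exists_equiv_slDeriv (hinj z hz t ht)
    exact ⟨ContinuousLinearEquiv.toUnit L, by rw [← hL]; rfl⟩
  -- Step 2: injectivity of the track near `[0, 1] × Z`
  have hK : IsCompact (Icc (0 : ℝ) 1 ×ˢ Z) := isCompact_Icc.prod hZ
  have htrack_cont : ContinuousOn (slTrack P) ((univ : Set ℝ) ×ˢ W) :=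
    (contDiffOn_slTrack hP).continuousOn
  have htrack_at : ∀ q ∈ S, ContDiffAt ℝ ∞ (slTrack P) q := fun q hq =>
    (contDiffOn_slTrack hP).contDiffAt ((isOpen_univ.prod hW).mem_nhds hq.1)
  obtain ⟨V, hVopen, hKV, hVinj⟩ : ∃ V : Set (ℝ × E), IsOpen V ∧ Icc (0 : ℝ) 1 ×ˢ Z ⊆ V ∧
      InjOn (slTrack P) V := by
    refine exists_isOpen_injOn_of_isCompact hK (fun q hq => ?_) (fun q hq q' hq' h => ?_)
      (fun q hq => ?_)
    · exact (htrack_at q (hKS hq)).continuousAt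
    · obtain ⟨t, z⟩ := q
      obtain ⟨t', z'⟩ := q'
      rw [slTrack_of_eq P (hPZ z hq.2), slTrack_of_eq P (hPZ z' hq'.2)] at h
      exact h
    · obtain ⟨T, hT⟩ := hequiv q (hKS hq)
      have hstrict : HasStrictFDerivAt (slTrack P) (T : ℝ × E →L[ℝ] ℝ × E) q := by
        have h1 := (htrack_at q (hKS hq)).hasStrictFDerivAt (by simp)
        rwa [hT.fderiv] at h1
      exact ⟨_, (hstrict.toOpenPartialHomeomorph _).open_source.mem_nhds
        hstrict.mem_toOpenPartialHomeomorph_source,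
        (hstrict.toOpenPartialHomeomorph _).injOn⟩
  -- the pairs `(t, y)` whose straight-line image `h_t(y)` lies in `W'` (open, contains
  -- `[0, 1] × Z` because `h_t = id` on `Z`)
  set G : Set (ℝ × E) :=
    ((univ : Set ℝ) ×ˢ W) ∩ (fun q : ℝ × E => slIsotopy P q.1 q.2) ⁻¹' W' with hG
  have hGopen : IsOpen G := by
    have hcont : ContinuousOn (fun q : ℝ × E => slIsotopy P q.1 q.2) ((univ : Set ℝ) ×ˢ W) :=
      htrack_cont.snd
    exact hcont.isOpen_inter_preimage (isOpen_univ.prod hW) hW'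
  have hKG : Icc (0 : ℝ) 1 ×ˢ Z ⊆ G := by
    rintro ⟨t, z⟩ ⟨-, hz⟩
    refine ⟨⟨mem_univ _, hZW hz⟩, ?_⟩
    show slIsotopy P t z ∈ W'
    rw [slIsotopy_of_eq P (hPZ z hz)]
    exact hZW' hz
  -- Step 3: a product neighbourhood `J × U` of `[0, 1] × Z` inside `S ∩ V ∩ G`, with
  -- `J ⊆ [-1, 2]`
  obtain ⟨J₀, U₀, hJ₀, hU₀, hIJ₀, hZU₀, hJU₀⟩ :=
    generalized_tube_lemma isCompact_Icc hZ ((hSopen.inter hVopen).inter hGopen)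
      (subset_inter (subset_inter hKS hKV) hKG)
  obtain ⟨δ₀, hδ₀, hδJ₀⟩ := isCompact_Icc.exists_thickening_subset_open hJ₀ hIJ₀
  set δ : ℝ := min δ₀ 1 with hδdef
  have hδ : 0 < δ := lt_min hδ₀ one_pos
  have hδ1 : δ ≤ 1 := min_le_right _ _
  have hδJ : thickening δ (Icc (0 : ℝ) 1) ⊆ J₀ :=
    (thickening_mono (min_le_left _ _) _).trans hδJ₀
  set J : Set ℝ := Ioo (-δ) (1 + δ) with hJ
  have hJsub : J ⊆ J₀ := by
    intro s hs
    apply hδJ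
    rw [mem_thickening_iff]
    rcases le_or_gt s 0 with h0 | h0
    · refine ⟨0, left_mem_Icc.2 zero_le_one, ?_⟩
      rw [dist_comm, Real.dist_eq, zero_sub, abs_neg, abs_of_nonpos h0]
      linarith [hs.1]
    rcases le_or_gt s 1 with h1 | h1
    · exact ⟨s, ⟨h0.le, h1⟩, by rw [dist_self]; exact hδ⟩
    · refine ⟨1, right_mem_Icc.2 zero_le_one, ?_⟩
      rw [Real.dist_eq, abs_of_pos (by linarith)]
      linarith [hs.2]
  have hJIcc : J ⊆ Icc (-1 : ℝ) 2 := fun s hs => ⟨by linarith [hs.1], by linarith [hs.2]⟩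
  obtain ⟨R₀, hR₀⟩ := hZ.isBounded.subset_ball 0
  set U : Set E := U₀ ∩ ball 0 R₀ with hU
  have hUopen : IsOpen U := hU₀.inter isOpen_ball
  have hZU : Z ⊆ U := subset_inter hZU₀ hR₀
  set O : Set (ℝ × E) := J ×ˢ U with hO
  have hOopen : IsOpen O := isOpen_Ioo.prod hUopen
  have hOS : O ⊆ S := fun q hq => (hJU₀ ⟨hJsub hq.1, hq.2.1⟩).1.1
  have hOV : O ⊆ V := fun q hq => (hJU₀ ⟨hJsub hq.1, hq.2.1⟩).1.2
  have hOW' : ∀ q ∈ O, slIsotopy P q.1 q.2 ∈ W' := fun q hq => (hJU₀ ⟨hJsub hq.1, hq.2.1⟩).2.2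
  have h0J : (0 : ℝ) ∈ J := ⟨by linarith, by linarith⟩
  have hUW : U ⊆ W := fun y hy => by
    have : ((0 : ℝ), y) ∈ S := hOS ⟨h0J, hy⟩
    exact this.1.2
  -- Step 4: the track as a partial diffeomorphism `e : O ≅ Ω`
  have hOinj : InjOn (slTrack P) O := hVinj.mono hOV
  set e₀ : PartialEquiv (ℝ × E) (ℝ × E) := hOinj.toPartialEquiv (slTrack P) O with he₀
  have hopenmap : IsOpenMap (O.restrict (slTrack P)) := by
    rw [isOpenMap_iff_nhds_le]
    rintro ⟨q, hq⟩
    obtain ⟨T, hT⟩ := hequiv q (hOS hq)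
    have hstrict : HasStrictFDerivAt (slTrack P) (T : ℝ × E →L[ℝ] ℝ × E) q := by
      have h1 := (htrack_at q (hOS hq)).hasStrictFDerivAt (by simp)
      rwa [hT.fderiv] at h1
    have hmap : map (O.restrict (slTrack P)) (𝓝 ⟨q, hq⟩) = map (slTrack P) (𝓝 q) := by
      rw [restrict_eq, ← Filter.map_map, map_nhds_subtype_val, hOopen.nhdsWithin_eq hq]
    rw [hmap, hstrict.map_nhds_eq_of_equiv]
    exact le_rfl
  set e : OpenPartialHomeomorph (ℝ × E) (ℝ × E) :=
    OpenPartialHomeomorph.ofContinuousOpenRestrict e₀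
      (htrack_cont.mono fun q hq => ⟨mem_univ _, hUW hq.2⟩) hopenmap hOopen with he
  have hecoe : ⇑e = slTrack P := rfl
  have hesource : e.source = O := rfl
  have hesymm_smooth : ContDiffOn ℝ ∞ e.symm e.target := by
    intro b hb
    have hb' : e.symm b ∈ O := e.map_target hb
    obtain ⟨T, hT⟩ := hequiv _ (hOS hb')
    exact (e.contDiffAt_symm hb hT (htrack_at _ (hOS hb'))).contDiffWithinAt
  -- Step 5: the vector field on `Ω = e.target` and its cutoff
  set Ω : Set (ℝ × E) := e.target with hΩ
  have hΩopen : IsOpen Ω := e.open_target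
  -- every point `b ∈ Ω` is `(t, h_t y')` with `(t, y') = e.symm b ∈ J × U`
  have hΩeq : ∀ b ∈ Ω, b = slTrack P (e.symm b) := fun b hb => by
    rw [← hecoe]; exact (e.right_inv hb).symm
  -- `Ω` lies over `W'`
  have hΩW' : ∀ b ∈ Ω, b.2 ∈ W' := fun b hb => by
    have hb' : e.symm b ∈ O := e.map_target hb
    rw [hΩeq b hb]
    exact hOW' _ hb'
  set Y : ℝ × E → E := fun q => P (e.symm q).2 - (e.symm q).2 with hY
  have hYsmooth : ContDiffOn ℝ ∞ Y Ω := by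
    have h2 : ContDiffOn ℝ ∞ (fun q => (e.symm q).2) Ω := hesymm_smooth.snd
    have hmaps : MapsTo (fun q => (e.symm q).2) Ω W := fun q hq => hUW (e.map_target hq).2
    exact (hP.comp h2 hmaps).sub h2
  -- **`Y` vanishes over `C`**: a point of `Ω` over `C` comes from a stationary track
  have hYC : ∀ b ∈ Ω, b.2 ∈ C → Y b = 0 := by
    intro b hb hbC
    have hb' : e.symm b ∈ O := e.map_target hb
    have hbeq := hΩeq b hb
    have h2 : b.2 = slIsotopy P (e.symm b).1 (e.symm b).2 := by
      have := congrArg Prod.snd hbeq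
      exact this
    have hfix : P (e.symm b).2 = (e.symm b).2 :=
      hCW _ (hUW hb'.2) _ (hJIcc hb'.1) (h2 ▸ hbC)
    simp only [hY, hfix, sub_self]
  -- a compact neighbourhood `Zc` of `Z` in `U` and the compact set `C'` of the track
  obtain ⟨Zc, hZc, hZZc, hZcU⟩ := exists_compact_between hZ hUopen hZU
  set C' : Set (ℝ × E) := slTrack P '' (Icc (-(δ / 2)) (1 + δ / 2) ×ˢ Zc) with hC'
  have hIccJ : Icc (-(δ / 2)) (1 + δ / 2) ⊆ J := fun s hs =>
    ⟨by linarith [hs.1], by linarith [hs.2]⟩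
  have hCO : Icc (-(δ / 2)) (1 + δ / 2) ×ˢ Zc ⊆ O := prod_mono hIccJ hZcU
  have hC'cpt : IsCompact C' := (isCompact_Icc.prod hZc).image_of_continuousOn
    ((htrack_cont.mono fun q hq => ⟨mem_univ _, hUW hq.2⟩).mono hCO)
  have hC'Ω : C' ⊆ Ω := by
    rintro _ ⟨q, hq, rfl⟩
    exact e.map_source (show q ∈ e.source from hCO hq)
  obtain ⟨t₁, ht₁, hC't₁, ht₁Ω⟩ := exists_compact_between hC'cpt hΩopen hC'Ω
  obtain ⟨ρ, hρ1, hρ0, hρ01⟩ := exists_contMDiffMap_one_nhds_of_subset_interior 𝓘(ℝ, ℝ × E)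
    hC'cpt.isClosed hC't₁ (n := (⊤ : ℕ∞))
  have hρsmooth : ContDiff ℝ ∞ (ρ : ℝ × E → ℝ) := contMDiff_iff_contDiff.1 ρ.contMDiff
  set X : ℝ × E → E := fun q => (ρ q) • Y q with hX
  have hXsmooth : ContDiff ℝ ∞ X := by
    refine contDiff_iff_contDiffAt.2 fun q => ?_
    by_cases hq : q ∈ Ω
    · exact (hρsmooth.contDiffAt).smul (hYsmooth.contDiffAt (hΩopen.mem_nhds hq))
    · have hq' : q ∉ t₁ := fun h => hq (ht₁Ω h)
      have hev : X =ᶠ[𝓝 q] fun _ => 0 := by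
        filter_upwards [ht₁.isClosed.isOpen_compl.mem_nhds hq'] with q' hq''
        simp only [hX, hρ0 q' hq'', zero_smul]
      exact contDiffAt_const.congr_of_eventuallyEq hev
  have hXsupp : HasCompactSupport X := by
    refine HasCompactSupport.of_support_subset_isCompact ht₁ fun q hq => ?_
    by_contra hq'
    exact hq (by simp only [hX, hρ0 q hq', zero_smul])
  -- **`X` vanishes over `C` and over `E ∖ W'` at all times**
  have hXC : ∀ (s : ℝ) (y : E), y ∈ C → X (s, y) = 0 := by
    intro s y hy
    by_cases hq : ((s, y) : ℝ × E) ∈ Ω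
    · simp only [hX, hYC _ hq hy, smul_zero]
    · have hq' : ((s, y) : ℝ × E) ∉ t₁ := fun h => hq (ht₁Ω h)
      simp only [hX, hρ0 _ hq', zero_smul]
  have hXW' : ∀ (s : ℝ) (y : E), y ∉ W' → X (s, y) = 0 := by
    intro s y hy
    have hq' : ((s, y) : ℝ × E) ∉ t₁ := fun h => hy (hΩW' _ (ht₁Ω h))
    simp only [hX, hρ0 _ hq', zero_smul]
  -- Step 6: the flow
  have hn : (1 : ℕ∞) ≤ ⊤ := le_top
  set Φ := Literature.Analysis.ODE.tdFlowDiffeomorph hXsmooth hXsupp hn 0 1 with hΦ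
  refine ⟨Φ, ?_, ?_, ?_, ?_⟩
  · -- agreement with `P` on `interior Zc`
    have hagree : ∀ p ∈ interior Zc, Φ p = P p := by
      intro p hp
      have hpZc : p ∈ Zc := interior_subset hp
      -- the straight line `s ↦ h_s p` is an integral curve of `X` on `(-δ/2, 1 + δ/2)`
      have hcurve : ∀ s ∈ Ioo (-(δ / 2)) (1 + δ / 2),
          HasDerivAt (fun s => slIsotopy P s p) (X (s, slIsotopy P s p)) s := by
        intro s hs
        have hsO : (s, p) ∈ O := hCO ⟨Ioo_subset_Icc_self hs, hpZc⟩
        have hval : X (s, slIsotopy P s p) = P p - p := by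
          have hmemC' : (s, slIsotopy P s p) ∈ C' :=
            ⟨(s, p), ⟨Ioo_subset_Icc_self hs, hpZc⟩, rfl⟩
          have hρq : ρ (s, slIsotopy P s p) = 1 := hρ1.self_of_nhdsSet _ hmemC'
          have hsymm : e.symm (s, slIsotopy P s p) = (s, p) := by
            have := e.left_inv (show (s, p) ∈ e.source from hsO)
            simpa [hecoe] using this
          simp only [hX, hY, hρq, one_smul, hsymm]
        rw [hval]
        have h1 : HasDerivAt (fun s : ℝ => s • (P p - p)) ((1 : ℝ) • (P p - p)) s :=
          (hasDerivAt_id s).smul_const _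
        rw [one_smul] at h1
        have h2 := h1.const_add p
        exact h2
      have key := Literature.Analysis.ODE.tdFlow_eq_of_hasDerivAt hXsmooth hXsupp hn
        (γ := fun s => slIsotopy P s p) (a := -(δ / 2)) (b := 1 + δ / 2) (t₀ := 0)
        ⟨by linarith, by linarith⟩ hcurve (t := 1) ⟨by linarith, by linarith⟩
      simp only [slIsotopy_zero, slIsotopy_one] at key
      rw [hΦ, Literature.Analysis.ODE.coe_tdFlowDiffeomorph]
      exact key
    exact Filter.eventually_of_mem (isOpen_interior.mem_nhdsSet.2 hZZc) hagree
  · -- `Φ = id` off `W'`: the field vanishes identically on `ℝ × (E ∖ W')`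
    intro y hy
    rw [hΦ, Literature.Analysis.ODE.coe_tdFlowDiffeomorph]
    exact Literature.Analysis.ODE.tdFlow_eq_self_of_forall_eq_zero hXsmooth hXsupp hn
      (fun s => hXW' s y hy) 0 1
  · -- **`Φ = id` on `C`**: the field vanishes identically on `ℝ × C`
    intro y hy
    rw [hΦ, Literature.Analysis.ODE.coe_tdFlowDiffeomorph]
    exact Literature.Analysis.ODE.tdFlow_eq_self_of_forall_eq_zero hXsmooth hXsupp hn
      (fun s => hXC s y hy) 0 1
  · obtain ⟨R, hR⟩ :=
      Literature.Analysis.ODE.exists_forall_le_norm_tdFlow_eq_self hXsmooth hXsupp hn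
    exact ⟨R, fun y hy => by
      rw [hΦ, Literature.Analysis.ODE.coe_tdFlowDiffeomorph]; exact hR y hy 0 1⟩

/-- **Isotopy extension for straight-line isotopies, support and relative version, local
hypothesis** (Hirsch (1976), Ch. 8 §1, Thms. 1.3–1.4). As
`exists_diffeomorph_eqOn_nhdsSet_of_straightLine_rel_of_forall`, the hypothesis on `C` being only
required for `y` in some neighbourhood of `Z`: if for `y` near `Z` and `t ∈ [-1, 2]` the membership
`h_t(y) ∈ C` forces `P y = y`, there is a diffeomorphism `Φ` of `E` with `Φ = P` near `Z`, `Φ = id`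
off the prescribed open `W' ⊇ Z`, `Φ = id` on `C`, and `Φ = id` off a ball (shrink `W` to that
neighbourhood). [cite: Hirsch1976, Ch. 8 §1, Thm. 1.3] -/
theorem exists_diffeomorph_eqOn_nhdsSet_of_straightLine_rel {Z W : Set E}
    (hZ : IsCompact Z) (hW : IsOpen W) (hZW : Z ⊆ W) {P : E → E} (hP : ContDiffOn ℝ ∞ P W)
    (hPZ : ∀ z ∈ Z, P z = z) {D : E → E →L[ℝ] E} (hD : ∀ z ∈ Z, HasFDerivAt P (D z) z)
    (hinj : ∀ z ∈ Z, ∀ t ∈ Icc (0 : ℝ) 1, Injective (slDeriv t (D z)))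
    {W' : Set E} (hW' : IsOpen W') (hZW' : Z ⊆ W') {C : Set E}
    (hC : ∀ᶠ y in 𝓝ˢ Z, ∀ t ∈ Icc (-1 : ℝ) 2, slIsotopy P t y ∈ C → P y = y) :
    ∃ Φ : E ≃ₘ⟮𝓘(ℝ, E), 𝓘(ℝ, E)⟯ E, (∀ᶠ y in 𝓝ˢ Z, Φ y = P y) ∧
      (∀ y, y ∉ W' → Φ y = y) ∧ (∀ y ∈ C, Φ y = y) ∧ ∃ R : ℝ, ∀ y : E, R ≤ ‖y‖ → Φ y = y := by
  obtain ⟨UC, hUC, hZUC, hUCp⟩ := mem_nhdsSet_iff_exists.1 hC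
  exact exists_diffeomorph_eqOn_nhdsSet_of_straightLine_rel_of_forall hZ (hW.inter hUC)
    (subset_inter hZW hZUC) (hP.mono inter_subset_left) hPZ hD hinj hW' hZW'
    fun y hy t ht hyt => hUCp hy.2 t ht hyt

end Extension

end Literature.Topology.FourManifolds

end
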